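import Summits.ResolutionOfSingularities.ResolutionOfSingularities.Theorems.HilbertSamuelEliminationCampaignW42ConeHilbertSamuel
import Literature.RingTheory.HilbertSamuel.FlatRegularFibreHilbert
import Literature.AlgebraicGeometry.Resolution.BlowupFibreConeModel
import Literature.AlgebraicGeometry.Resolution.AffineDomainEquidim
import HarnessLib

/-!
# [OURS · L1 W4.2] Towards ridge confinement at NON-rational closed points, I: the point extension of the
# local ring of a cone at a closed point (campaign s42 of cell res-hironaka, LADDER-RESOLUTION rung L;
# informal crux `RidgeConfinement`, stmt-ResolutionOfSingularities-17845; `--supports`)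

HONEST FRAMING. OURS (slot W4.2, prover res-L1-s42-pv-1, gen 2). The cone theorem of
`…CampaignW42RidgeConeNear.lean` treats RATIONAL points; a closed point `𝔮` of the cone `C = V(I)` with a
non-trivial residue extension `κ = K[X]/𝔮 ⊋ K` (possibly INSEPARABLE: Hironaka's phenomenon, CJS Ex. 18.30)
is handled, following Hironaka [H4] / CJS (proof of Thm. 3.10, p. 47), by comparing the local ring
`A = 𝒪_{C,𝔮}` with the local ring `B` of the base-changed cone `C_κ` at its rational point `w = (X̄_i)_i`
through the "point extension" `L = (A[Z_1, …, Z_n])_{(𝔪_A, Z)}`. This file builds `L` and proves the first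
comparison (CJS Lemma 2.27 (2) / 2.37 (1)):

  **`H⁽⁰⁾(L) = H⁽ⁿ⁾(A)`** (`hilbertFun_localization_frame_eq`)

by the tree's `hilbertFun_eq_hilbertSamuelFun_of_flat_of_isRegularLocalRing_fiber`: `A → L` is flat (a
localization of a polynomial ring over `T = K[X]/I`, `A = T_𝔮`) and its fibre `L/𝔪_A L = κ[Z]_{(Z)}` is
regular of dimension `n`. NOTHING here is a statement of H. Hironaka's manuscript [Hironaka2017]. AI review
is weaker than expert review.

## Objects (`S = K[X_1..X_n]`, `I ⊆ 𝔮 ⊆ S`, `𝔮` maximal)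

* `T = S/I`, `𝔮_T = 𝔮/I` (maximal: `isMaximal_map_mk_of_le`), `R = T[Z_1, …, Z_n]`,
  `𝔑 = 𝔮_T R + (Z_1, …, Z_n)` — the kernel of `R → T/𝔮_T = κ`, `Z ↦ 0` (`ker_quotient_comp_eval_zero`),
  a maximal ideal (`isMaximal_map_C_sup_idealOfVars`) with `𝔑 ∩ T = 𝔮_T` (`comap_C_map_C_sup_idealOfVars`);
* `L = R_𝔑`, an algebra over `A = T_{𝔮_T}` (`Localization.localRingHom`), flat
  (`Module.flat_iff_of_isLocalization`), with fibre `L/𝔪_A L ≅ (κ[Z])_{(Z)}` regular of dimension `n`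
  (`isRegularLocalRing_fibre_frame`: Mathlib's `IsRegularRing (MvPolynomial _ κ)`
  and the tree's `MvPolynomial.height_eq_of_isMaximal`).

References (orientation only): V. Cossart, U. Jannsen, S. Saito, LNM 2270 (2020), Lemma 2.27 (2), Lemma 2.37 (1),
proof of Thm. 3.10 (p. 47); H. Hironaka, J. Math. Kyoto Univ. 10 (1970) ([H4] of CJS).
-/

noncomputable section

-- single-conjunct summit: the doubled namespace component `ResolutionOfSingularities` is mandated
set_option linter.dupNamespace false

open MvPolynomial Module IsLocalRing
open Literature.RingTheory.HilbertSamuel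
open Literature.AlgebraicGeometry.Resolution

namespace Summit.ResolutionOfSingularities.ResolutionOfSingularities.Theorems

namespace CampaignW42

universe u

/-! ## Generic: the ideal `(𝔭, Z)` of `T[Z]` -/

section Generic

variable {T : Type u} [CommRing T] {n : ℕ}

/-- `p − p(0) ∈ (Z_1, …, Z_n)` in `T[Z]`. [folklore] -/
theorem sub_C_eval_zero_mem_idealOfVars (p : MvPolynomial (Fin n) T) :
    p - C (eval 0 p) ∈ idealOfVars (Fin n) T := by
  rw [← pow_one (idealOfVars (Fin n) T), mem_pow_idealOfVars_iff']
  intro x hx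
  have hx0 : x = 0 := (Finsupp.degree_eq_zero_iff x).mp (by omega)
  subst hx0
  rw [coeff_sub, MvPolynomial.eval_zero, constantCoeff_eq, coeff_zero_C, sub_self]

/-- **`(𝔭, Z)` is the kernel of `T[Z] → T/𝔭`, `Z ↦ 0`.** [folklore] -/
theorem ker_quotient_comp_eval_zero (𝔭 : Ideal T) :
    RingHom.ker ((Ideal.Quotient.mk 𝔭).comp (eval (0 : Fin n → T))) =
      𝔭.map (C : T →+* MvPolynomial (Fin n) T) ⊔ idealOfVars (Fin n) T := by
  refine le_antisymm ?_ (sup_le ?_ ?_)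
  · intro p hp
    rw [RingHom.mem_ker, RingHom.comp_apply, Ideal.Quotient.eq_zero_iff_mem] at hp
    have h : p = C (eval 0 p) + (p - C (eval 0 p)) := by ring
    rw [h]
    exact Submodule.add_mem_sup (Ideal.mem_map_of_mem _ hp) (sub_C_eval_zero_mem_idealOfVars p)
  · rw [Ideal.map_le_iff_le_comap]
    intro t ht
    rw [Ideal.mem_comap, RingHom.mem_ker, RingHom.comp_apply, eval_C, Ideal.Quotient.eq_zero_iff_mem]
    exact ht
  · rw [idealOfVars, Ideal.span_le]
    rintro _ ⟨i, rfl⟩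
    rw [SetLike.mem_coe, RingHom.mem_ker, RingHom.comp_apply, eval_X, Pi.zero_apply, map_zero]

/-- `T[Z] → T/𝔭`, `Z ↦ 0`, is onto. [folklore] -/
theorem surjective_quotient_comp_eval_zero (𝔭 : Ideal T) :
    Function.Surjective ((Ideal.Quotient.mk 𝔭).comp (eval (0 : Fin n → T))) := fun x => by
  obtain ⟨t, rfl⟩ := Ideal.Quotient.mk_surjective x
  exact ⟨C t, by rw [RingHom.comp_apply, eval_C]⟩

/-- **`(𝔭, Z)` is maximal** for `𝔭` maximal. [folklore] -/
theorem isMaximal_map_C_sup_idealOfVars (𝔭 : Ideal T) [h𝔭 : 𝔭.IsMaximal] :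
    (𝔭.map (C : T →+* MvPolynomial (Fin n) T) ⊔ idealOfVars (Fin n) T).IsMaximal := by
  rw [← ker_quotient_comp_eval_zero]
  letI := Ideal.Quotient.field 𝔭
  exact RingHom.ker_isMaximal_of_surjective _ (surjective_quotient_comp_eval_zero 𝔭)

/-- **`(𝔭, Z) ∩ T = 𝔭`.** [folklore] -/
theorem comap_C_map_C_sup_idealOfVars (𝔭 : Ideal T) :
    (𝔭.map (C : T →+* MvPolynomial (Fin n) T) ⊔ idealOfVars (Fin n) T).comap C = 𝔭 := by
  ext t
  rw [Ideal.mem_comap, ← ker_quotient_comp_eval_zero, RingHom.mem_ker, RingHom.comp_apply, eval_C,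
    Ideal.Quotient.eq_zero_iff_mem]

/-- The image of a maximal ideal `𝔮 ⊇ I` in `S/I` is maximal. [folklore] -/
theorem isMaximal_map_mk_of_le {S : Type u} [CommRing S] {I 𝔮 : Ideal S} (h𝔮 : 𝔮.IsMaximal) (hI : I ≤ 𝔮) :
    (𝔮.map (Ideal.Quotient.mk I)).IsMaximal := by
  refine (Ideal.map_eq_top_or_isMaximal_of_surjective _ Ideal.Quotient.mk_surjective h𝔮).resolve_left
    fun htop => h𝔮.ne_top ?_
  have h := Ideal.comap_map_of_surjective (Ideal.Quotient.mk I) Ideal.Quotient.mk_surjective 𝔮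
  rw [htop, Ideal.comap_top, ← RingHom.ker_eq_comap_bot, Ideal.mk_ker, sup_eq_left.mpr hI] at h
  exact h.symm

end Generic

/-! ## The fibre: `(T[Z])_{(𝔭,Z)} / 𝔭 ≅ (κ[Z])_{(Z)}` is regular of dimension `n` -/

section ResidueField

variable {T : Type u} [CommRing T] {n : ℕ} (𝔭 : Ideal T) [𝔭.IsMaximal]

/-- `(Z) ⊆ κ[Z]` is maximal for the residue field `κ = T/𝔭`. [folklore] -/
theorem isMaximal_idealOfVars_quotient : (idealOfVars (Fin n) (T ⧸ 𝔭)).IsMaximal := by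
  letI : Field (T ⧸ 𝔭) := Ideal.Quotient.field 𝔭
  have h : (RingHom.ker (eval (0 : Fin n → T ⧸ 𝔭))).IsMaximal :=
    RingHom.ker_isMaximal_of_surjective _ fun c => ⟨C c, eval_C c⟩
  have h2 : RingHom.ker (eval (0 : Fin n → T ⧸ 𝔭)) = idealOfVars (Fin n) (T ⧸ 𝔭) := ker_eval_zero
  rw [h2] at h
  exact h

/-- `ht (Z) = n` in `κ[Z_1, …, Z_n]` (tree `MvPolynomial.height_eq_of_isMaximal`). [folklore] -/
theorem height_idealOfVars_quotient : (idealOfVars (Fin n) (T ⧸ 𝔭)).height = n := by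
  letI : Field (T ⧸ 𝔭) := Ideal.Quotient.field 𝔭
  haveI := isMaximal_idealOfVars_quotient (n := n) 𝔭
  exact MvPolynomial.height_eq_of_isMaximal (T ⧸ 𝔭) n _

/-- `(κ[Z])_{(Z)}` is a regular local ring (Mathlib: `κ[Z]` is a regular ring). [folklore] -/
theorem isRegularLocalRing_localization_idealOfVars_quotient [(idealOfVars (Fin n) (T ⧸ 𝔭)).IsPrime] :
    IsRegularLocalRing (Localization.AtPrime (idealOfVars (Fin n) (T ⧸ 𝔭))) := by
  letI : Field (T ⧸ 𝔭) := Ideal.Quotient.field 𝔭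
  exact IsRegularRing.isRegularLocalRing_localization _

end ResidueField

section Fibre

variable {T : Type u} [CommRing T] {n : ℕ} (𝔭 : Ideal T) [𝔭.IsMaximal]
  [(𝔭.map (C : T →+* MvPolynomial (Fin n) T) ⊔ idealOfVars (Fin n) T).IsPrime]
  (L : Type u) [CommRing L] [Algebra (MvPolynomial (Fin n) T) L]
  [IsLocalization.AtPrime L (𝔭.map (C : T →+* MvPolynomial (Fin n) T) ⊔ idealOfVars (Fin n) T)]

/-- **The fibre `L/𝔭L` of `L = (T[Z])_{(𝔭, Z)}` is `(κ[Z])_{(Z)}` (`κ = T/𝔭`), a regular local ring of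
dimension `n`.** [folklore] -/
theorem isRegularLocalRing_fibre_frame :
    IsRegularLocalRing (L ⧸ (𝔭.map (C : T →+* MvPolynomial (Fin n) T)).map
        (algebraMap (MvPolynomial (Fin n) T) L)) ∧
      ringKrullDim (L ⧸ (𝔭.map (C : T →+* MvPolynomial (Fin n) T)).map
        (algebraMap (MvPolynomial (Fin n) T) L)) = n := by
  set Q : Ideal (MvPolynomial (Fin n) T) := 𝔭.map (C : T →+* MvPolynomial (Fin n) T) with hQ
  set 𝔑 : Ideal (MvPolynomial (Fin n) T) := Q ⊔ idealOfVars (Fin n) T with h𝔑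
  have hQ𝔑 : Q ≤ 𝔑 := le_sup_left
  haveI := isPrime_map_quotientMk_of_le (E := Q) (Q := 𝔑) hQ𝔑
  haveI : IsLocalization.AtPrime (L ⧸ Q.map (algebraMap (MvPolynomial (Fin n) T) L))
      (𝔑.map (Ideal.Quotient.mk Q)) :=
    isLocalization_atPrime_quotient_mapExt_of_le hQ𝔑 L
  haveI hmax : (idealOfVars (Fin n) (T ⧸ 𝔭)).IsMaximal := isMaximal_idealOfVars_quotient 𝔭
  -- transport the base along `e : T[Z]/Q ≅ κ[Z]`
  have hfwd : ∀ i, (MvPolynomial.quotientEquivQuotientMvPolynomial (σ := Fin n) 𝔭) (X i) =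
      Ideal.Quotient.mk Q (X i) := fun i => by
    show MvPolynomial.eval₂Hom _ _ (X i) = _
    exact MvPolynomial.eval₂Hom_X' _ _ i
  let e : (MvPolynomial (Fin n) T ⧸ Q) ≃+* MvPolynomial (Fin n) (T ⧸ 𝔭) :=
    (MvPolynomial.quotientEquivQuotientMvPolynomial (σ := Fin n) 𝔭).symm.toRingEquiv
  have heX : ∀ i, e (Ideal.Quotient.mk Q (X i)) = X i := fun i => by
    change (MvPolynomial.quotientEquivQuotientMvPolynomial (σ := Fin n) 𝔭).symm (Ideal.Quotient.mk Q (X i)) = X i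
    rw [AlgEquiv.symm_apply_eq, hfwd]
  have hmap : (𝔑.map (Ideal.Quotient.mk Q)).map e = idealOfVars (Fin n) (T ⧸ 𝔭) := by
    have h1 : 𝔑.map (Ideal.Quotient.mk Q) = Ideal.span (Set.range fun i => Ideal.Quotient.mk Q (X i)) := by
      rw [h𝔑, Ideal.map_sup, Ideal.map_quotient_self, bot_sup_eq, idealOfVars, Ideal.map_span,
        ← Set.range_comp]
      rfl
    have hset : Set.range (fun i => e (Ideal.Quotient.mk Q (X i))) =
        Set.range (X : Fin n → MvPolynomial (Fin n) (T ⧸ 𝔭)) := by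
      simp_rw [heX]
    rw [h1, Ideal.map_span, ← Set.range_comp]
    exact congrArg Ideal.span hset
  have hM : (𝔑.map (Ideal.Quotient.mk Q)).primeCompl.map e.toMonoidHom =
      (idealOfVars (Fin n) (T ⧸ 𝔭)).primeCompl := by
    ext x
    simp only [Submonoid.mem_map, Ideal.mem_primeCompl_iff]
    constructor
    · rintro ⟨y, hy, rfl⟩ hx
      apply hy
      change e y ∈ _ at hx
      have h1 : e.symm (e y) ∈ (idealOfVars (Fin n) (T ⧸ 𝔭)).comap e := by
        rw [Ideal.mem_comap, RingEquiv.apply_symm_apply]; exact hx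
      rwa [← hmap, Ideal.comap_map_of_bijective _ e.bijective, RingEquiv.symm_apply_apply] at h1
    · intro hx
      refine ⟨e.symm x, fun hy => hx ?_, ?_⟩
      swap
      · change e (e.symm x) = x
        exact e.apply_symm_apply x
      rw [← hmap]
      have := Ideal.mem_map_of_mem e hy
      rwa [RingEquiv.apply_symm_apply] at this
  let f : (L ⧸ Q.map (algebraMap (MvPolynomial (Fin n) T) L)) ≃+*
      Localization.AtPrime (idealOfVars (Fin n) (T ⧸ 𝔭)) :=
    IsLocalization.ringEquivOfRingEquiv (L ⧸ Q.map (algebraMap (MvPolynomial (Fin n) T) L))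
      (Localization.AtPrime (idealOfVars (Fin n) (T ⧸ 𝔭))) e hM
  haveI := isRegularLocalRing_localization_idealOfVars_quotient (n := n) 𝔭
  have f' : Localization.AtPrime (idealOfVars (Fin n) (T ⧸ 𝔭)) ≃+*
      (L ⧸ Q.map (algebraMap (MvPolynomial (Fin n) T) L)) := f.symm
  refine ⟨IsRegularLocalRing.of_ringEquiv (R := Localization.AtPrime (idealOfVars (Fin n) (T ⧸ 𝔭))) f', ?_⟩
  have hdim : ringKrullDim (Localization.AtPrime (idealOfVars (Fin n) (T ⧸ 𝔭))) = n := by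
    rw [IsLocalization.AtPrime.ringKrullDim_eq_height (idealOfVars (Fin n) (T ⧸ 𝔭))
      (Localization.AtPrime (idealOfVars (Fin n) (T ⧸ 𝔭))), height_idealOfVars_quotient 𝔭]
    rfl
  rw [← hdim]
  exact (ringKrullDim_eq_of_ringEquiv f').symm

end Fibre

/-! ## `H⁽⁰⁾(L) = H⁽ⁿ⁾(A)` for `A = T_𝔭`, `L = (T[Z])_{(𝔭, Z)}` -/

section PointExtension

variable {T : Type u} [CommRing T] [IsNoetherianRing T] {n : ℕ} (𝔭 : Ideal T) [𝔭.IsMaximal]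
  [(𝔭.map (C : T →+* MvPolynomial (Fin n) T) ⊔ idealOfVars (Fin n) T).IsPrime]

/-- **The `n`-variable point extension: `H⁽⁰⁾((T[Z])_{(𝔭,Z)}) = H⁽ⁿ⁾(T_𝔭)`** (CJS Lemma 2.27 (2) / 2.37 (1):
`T_𝔭 → (T[Z])_{(𝔭,Z)}` is flat with regular fibre `(κ[Z])_{(Z)}` of dimension `n`).
[cite: CossartJannsenSaito2020, Lemma 2.37 (1)] -/
theorem hilbertFun_localization_frame_eq :
    hilbertFun (Localization.AtPrime (𝔭.map (C : T →+* MvPolynomial (Fin n) T) ⊔ idealOfVars (Fin n) T)) =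
      hilbertSamuelFun (Localization.AtPrime 𝔭) n := by
  set 𝔑 : Ideal (MvPolynomial (Fin n) T) := 𝔭.map (C : T →+* MvPolynomial (Fin n) T) ⊔ idealOfVars (Fin n) T
    with h𝔑
  set A := Localization.AtPrime 𝔭
  set L := Localization.AtPrime 𝔑
  have hcomap : 𝔭 = 𝔑.comap (C : T →+* MvPolynomial (Fin n) T) := (comap_C_map_C_sup_idealOfVars 𝔭).symm
  let φ : A →+* L := Localization.localRingHom 𝔭 𝔑 (C : T →+* MvPolynomial (Fin n) T) hcomap
  letI : Algebra A L := φ.toAlgebra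
  have hφ : ∀ t : T, algebraMap A L (algebraMap T A t) = algebraMap (MvPolynomial (Fin n) T) L (C t) :=
    fun t => Localization.localRingHom_to_map 𝔭 𝔑 _ hcomap t
  haveI : IsScalarTower T A L := IsScalarTower.of_algebraMap_eq fun t => by
    rw [hφ, IsScalarTower.algebraMap_apply T (MvPolynomial (Fin n) T) L, MvPolynomial.algebraMap_eq]
  haveI : Module.Flat T L := Localization.flat (R := T) (S := MvPolynomial (Fin n) T) 𝔑.primeCompl
  haveI : Module.Flat A L := (Module.flat_iff_of_isLocalization A 𝔭.primeCompl L).mpr inferInstance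
  have hQ : (maximalIdeal A).map (algebraMap A L) =
      (𝔭.map (C : T →+* MvPolynomial (Fin n) T)).map (algebraMap (MvPolynomial (Fin n) T) L) := by
    rw [← Localization.AtPrime.map_eq_maximalIdeal, Ideal.map_map, Ideal.map_map]
    congr 1
    exact RingHom.ext hφ
  obtain ⟨hreg, hdim⟩ := isRegularLocalRing_fibre_frame (n := n) 𝔭 L
  haveI : IsRegularLocalRing (L ⧸ (maximalIdeal A).map (algebraMap A L)) := by
    rw [hQ]
    exact hreg
  have hd : ringKrullDim (L ⧸ (maximalIdeal A).map (algebraMap A L)) = n := by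
    rw [hQ]
    exact hdim
  exact hilbertFun_eq_hilbertSamuelFun_of_flat_of_isRegularLocalRing_fiber hd

end PointExtension

end CampaignW42

end Summit.ResolutionOfSingularities.ResolutionOfSingularities.Theorems
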